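import Mathlib
import HarnessLib
import Summits.HubbardSuperconductivity.HubbardSuperconductivity.Theorems.KLProgrammeKLRegimeEngineMeanFreeBaseFrame
import Summits.HubbardSuperconductivity.HubbardSuperconductivity.Theorems.KLProgrammeKLRegimeSectorMultiplierOverlapWtFlowDeep

/-!
# K3 ENGINE child (stmt-HubbardSuperconductivity-20437), stub (b), (F1)/(c-D) telescope: the WEIGHTED overlap / re-sectorisation constants
# (`cr/cc` = `hrow′/hcol′` of `EngineV8.klNormsStepWt_of_sliceConsts`) of `E(klAnisoFamily J′)·S(F̃_k)` **AT THE MEAN-FREE BASE FRAME**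
# `K♯ = K_{m₀} ⊖ Σ_{m₀≤m<n} mean_m` (F1-DESIGN.md §1 «O(m₀)»), ONE R-free constant per jump allowance `d`

Cell `gate-hubbard-kl`, seat p3 (g11); item «MF-BASE», the W2 twin of `…AlphaWtMeanFreeBase` (pen (R68e): the telescope starts at the R-free window
edge).  Same pattern: `charSumWt_klAnisoPair_nb_of_thresholds` at `(μ, K♯)` with the bumped package `R♭ = ⟨cr, cz, Gfr[0 ↦ Gfr₀ + cr·klE0]⟩`
(`frameOK_meanFreeBase`), order-three datum = that of `K_{m₀}` (`iteratedFDeriv_frameShift_fsub_symInterp_const`, `frameDatumAt_le_of_pow_window`), the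
windowed jump package `overlapWt_jump_sums_le_of_nbWindow` verbatim.

* **`overlapWt_jump_sums_klEng_meanFreeBase (d)`** — `∃ C_J > 0`: stub-(b) binders + the single own door
  `U ≤ klEngU₀3 P R cc / (2¹²·(Gfr₀+Gfr₁+Gfr₃+cr+1))`, `n ≤ n_β + 1`, `IsKLRegime U cc (−n)`, `HistP … 0 n`, `1 ≤ m₀ ≤ n`, `k + 1 ≤ J′ ≤ m₀`,
  `4^{m₀}·U ≤ 4^{2(k+1)+d}`: weighted row sums `≤ 81·C_J·M/β`, weighted per-pair position sums (both orientations) `≤ 3·C_J·M/β` for the families on `(μ, K♯)`;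
* **`overlapWt_jump_sums_klEng_meanFreeBase_shifted (d)`** — the same in the (K5′) chain's spelling `(μ + −Σ_{m<n} mean_m, K_{m₀} ⊖ (−Σ_{m<m₀} mean_m))`
  (`klAnisoFamily`, `bgmFatMultiplier ∘ nambuXiCT` read the band only: `nambuXiCT_meanFree_eq_base`).

Everything is proved; no definitions; nothing about the model is asserted. [cite: BenfattoGiulianiMastropietro2006, §2.7 (2.71a), §2.8 (2.77), (2.82)–(2.83)]
-/

noncomputable section

namespace Summit.HubbardSuperconductivity.HubbardSuperconductivity.Theorems.TorusFourierL2

set_option linter.dupNamespace false -- summit = problem name (single-conjunct summit), D-0017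

open Set Finset Literature.MathematicalPhysics.QuantumLattice Literature.MathematicalPhysics.QuantumLattice.BandSectorCounting
open Literature.MathematicalPhysics.QuantumLattice.FermiRG Literature.Probability.LatticeModels Literature.Analysis.SpecialFunctions
open Summit.HubbardSuperconductivity.HubbardSuperconductivity.Theorems.DispersionFlow
open Summit.HubbardSuperconductivity.HubbardSuperconductivity.Theorems.KLRegimeSplit
open Summit.HubbardSuperconductivity.HubbardSuperconductivity.Theorems.KLProgrammeLegKernels
open Summit.HubbardSuperconductivity.HubbardSuperconductivity.Theorems.PerturbedFermiCurve
open scoped Real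

open Classical

set_option maxHeartbeats 1600000 in -- long regime bookkeeping
/-- **The WEIGHTED overlap constants of `E(klAnisoFamily J′)·S(F̃_k)` AT THE MEAN-FREE BASE FRAME `K♯ = K_{m₀} ⊖ Σ_{m₀≤m<n} mean_m`, level `μ`,
in the KL regime** (see the module docstring): `overlapWt_jump_sums_klEng_flow_deep`'s conclusion at `K♯` instead of `K_{m₀}`, from `HistP … 0 n`,
`IsKLRegime U cc (−n)` and the deep window `4^{m₀}·U ≤ 4^{2(k+1)+d}`; one constant per `d`, `R`-free. [cite: BenfattoGiulianiMastropietro2006, §2.7 (2.71a), §2.8 (2.77), (2.82)–(2.83)] -/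
theorem overlapWt_jump_sums_klEng_meanFreeBase (dd : ℕ) :
    ∃ CJ : ℝ, 0 < CJ ∧
      ∀ (G : GeoConsts) (P : SplitConsts) (R : RenConsts) (Q : EngConsts) (cc : ℝ), R.WF2 → 0 < cc → cc ≤ EngineV8.klEngC₃6 P R →
      ∀ μ ∈ klWindowC, ∀ U : ℝ, 0 < U → U ≤ EngineV8.klEngU₀3 P R cc / (2 ^ 12 * (R.Gfr 0 + R.Gfr 1 + R.Gfr 3 + R.cr + 1)) →
      ∀ β : ℝ, klBetaMin ≤ β → β ≤ Real.exp (cc / U ^ 2) →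
      ∀ (L M : ℕ) [NeZero L] [NeZero M], EngineV8.klEngL₃ β U ≤ L → EngineV8.klEngM₃ β U L ≤ M →
      ∀ n : ℕ, n ≤ nScales β + 1 → IsKLRegime U cc (-(n : ℤ)) → HistP klPredsV17F2 L M G P Q R β U μ 0 n →
        ∀ m₀ : ℕ, 1 ≤ m₀ → m₀ ≤ n →
        ∀ k J' : ℕ, k + 1 ≤ J' → J' ≤ m₀ → (4 : ℝ) ^ m₀ * U ≤ (4 : ℝ) ^ (2 * (k + 1) + dd) →
        (∀ X'' : SpaceTimeIdx L M × SectorLeg (sectorCount J'),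
          ∑ X', ‖(sectorAnalysisMatrix L M β (klAnisoFamily L M β μ (fsub (klFlowFrameU L M β U μ m₀) (symInterp L fun _ => ∑ m ∈ Ico m₀ n, klAngularMean (klLocalPart L M β U μ (klFlowFrameU L M β U μ m) m))) klE0 J') *
            sectorSubMatrix L M β (bgmFatMultiplier L M klE0 β (nambuXiCT L μ (fsub (klFlowFrameU L M β U μ m₀) (symInterp L fun _ => ∑ m ∈ Ico m₀ n, klAngularMean (klLocalPart L M β U μ (klFlowFrameU L M β U μ m) m)))) k)) X'' X'‖ *
              EngineV8.klScaleWt L M β J' {EngineV8.latticeLegPos (2 * (2 * M)) X'', EngineV8.latticeLegPos (2 * (2 * M)) X'} ≤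
            81 * CJ * M / β) ∧
        (∀ (ω'' : Fin (sectorCount J')) (ω' : Fin (sectorCount k)) (σ c : Fin 2) (x' : SpaceTimeIdx L M),
          ∑ x'' : SpaceTimeIdx L M, ‖(sectorAnalysisMatrix L M β (klAnisoFamily L M β μ (fsub (klFlowFrameU L M β U μ m₀) (symInterp L fun _ => ∑ m ∈ Ico m₀ n, klAngularMean (klLocalPart L M β U μ (klFlowFrameU L M β U μ m) m))) klE0 J') *
            sectorSubMatrix L M β (bgmFatMultiplier L M klE0 β (nambuXiCT L μ (fsub (klFlowFrameU L M β U μ m₀) (symInterp L fun _ => ∑ m ∈ Ico m₀ n, klAngularMean (klLocalPart L M β U μ (klFlowFrameU L M β U μ m) m)))) k))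
              (x'', ((ω'', σ), c)) (x', ((ω', σ), c))‖ *
              EngineV8.klScaleWt L M β J'
                {EngineV8.latticeLegPos (2 * (2 * M)) ((x'', ((ω'', σ), c)) : SpaceTimeIdx L M × SectorLeg (sectorCount J')),
                  EngineV8.latticeLegPos (2 * (2 * M)) ((x', ((ω', σ), c)) : SpaceTimeIdx L M × SectorLeg (sectorCount k))} ≤
            3 * CJ * M / β) ∧
        (∀ (ω'' : Fin (sectorCount J')) (ω' : Fin (sectorCount k)) (σ c : Fin 2) (x'' : SpaceTimeIdx L M),
          ∑ x' : SpaceTimeIdx L M, ‖(sectorAnalysisMatrix L M β (klAnisoFamily L M β μ (fsub (klFlowFrameU L M β U μ m₀) (symInterp L fun _ => ∑ m ∈ Ico m₀ n, klAngularMean (klLocalPart L M β U μ (klFlowFrameU L M β U μ m) m))) klE0 J') *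
            sectorSubMatrix L M β (bgmFatMultiplier L M klE0 β (nambuXiCT L μ (fsub (klFlowFrameU L M β U μ m₀) (symInterp L fun _ => ∑ m ∈ Ico m₀ n, klAngularMean (klLocalPart L M β U μ (klFlowFrameU L M β U μ m) m)))) k))
              (x'', ((ω'', σ), c)) (x', ((ω', σ), c))‖ *
              EngineV8.klScaleWt L M β J'
                {EngineV8.latticeLegPos (2 * (2 * M)) ((x'', ((ω'', σ), c)) : SpaceTimeIdx L M × SectorLeg (sectorCount J')),
                  EngineV8.latticeLegPos (2 * (2 * M)) ((x', ((ω', σ), c)) : SpaceTimeIdx L M × SectorLeg (sectorCount k))} ≤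
            3 * CJ * M / β) := by
  have ha : (-4 : ℝ) < -(6 / 5) := by norm_num
  have hab : (-(6 / 5) : ℝ) ≤ -(1 / 10) := by norm_num
  have hb : (-(1 / 10) : ℝ) < 0 := by norm_num
  obtain ⟨CT, hCT, h⟩ := charSumWt_klAnisoPair_nb_of_thresholds ha hab hb ((4 : ℝ) ^ dd / 3072)
  refine ⟨CT + 729 * CT ^ 2 / 2, by positivity, ?_⟩
  intro G P R Q cc hR2 hcc hcc6 μ hμ U hU hUle β hβmin hβc L M _ _ hL3 hM3 n hnN hreg hhist m₀ hm1 hmn k J' hJ hJm hnd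
  have hRj : ∀ j, 0 ≤ R.Gfr j := EngineV8.gfr_nonneg_of_wf2 hR2
  have hcr : 0 ≤ R.cr := hR2.1.1
  have he : (0 : ℝ) < klE0 := by norm_num [klE0]
  have hβ0 : 0 < β := pos_of_klBetaMin_le hβmin
  have hL0 : (0 : ℝ) < L := Nat.cast_pos.2 (Nat.pos_of_ne_zero (NeZero.ne L))
  have hM0 : (0 : ℝ) < M := Nat.cast_pos.2 (Nat.pos_of_ne_zero (NeZero.ne M))
  -- the bumped package of the base frame
  set Rb : RenConsts := ⟨R.cr, R.cz, fun i => if i = 0 then R.Gfr 0 + R.cr * klE0 else R.Gfr i⟩ with hRb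
  have hRb0 : Rb.Gfr 0 = R.Gfr 0 + R.cr * klE0 := by simp [hRb]
  have hRbj : ∀ i, i ≠ 0 → Rb.Gfr i = R.Gfr i := fun i hi => by simp [hRb, hi]
  have hRbnn : ∀ i, 0 ≤ Rb.Gfr i := by
    intro i
    by_cases hi : i = 0
    · subst hi; rw [hRb0]; have := hRj 0; positivity
    · rw [hRbj i hi]; exact hRj i
  have hcle := (hcc6.trans (EngineV8.klEngC₃6_le_klEngC₃3 P R)).trans (EngineV8.klEngC₃3_le_symbolC₃ ha hab hb P hRj)
  have hcleb : cc ≤ min (min ((bandBounds ha hab hb).Dtmin / 4) ((bandBounds ha hab hb).rhomin / 4)) (1 / 40) / (12 * (Rb.Gfr 2 + 1)) := by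
    rw [hRbj 2 two_ne_zero]; exact hcle
  have hcc480 : cc ≤ 1 / (480 * (R.Gfr 2 + 1)) := by
    refine hcle.trans ?_
    have hG2 : 0 < 12 * (R.Gfr 2 + 1) := by have := hRj 2; positivity
    rw [div_le_div_iff₀ hG2 (by have := hRj 2; positivity)]
    have hk : min (min ((bandBounds ha hab hb).Dtmin / 4) ((bandBounds ha hab hb).rhomin / 4)) (1 / 40) ≤ 1 / 40 := min_le_right _ _
    nlinarith [hk, hRj 2]
  -- the U-hypotheses from the single door
  have hU3R := EngineV8.klEngU₀3_le_symbolU₀ ha hab hb P hRj cc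
  set X : ℝ := R.Gfr 0 + R.Gfr 1 + R.Gfr 3 + R.cr with hXdef
  have hX0 : 0 ≤ X := by rw [hXdef]; linarith [hRj 0, hRj 1, hRj 3]
  have hD : (1 : ℝ) ≤ 2 ^ 12 * (X + 1) := by nlinarith [hX0]
  have hE3le1 : EngineV8.klEngU₀3 P R cc ≤ 1 := hU3R.trans (min_le_left _ _)
  have hE3nn : 0 ≤ EngineV8.klEngU₀3 P R cc := by
    have := hU.le.trans hUle
    rw [le_div_iff₀ (by positivity)] at this
    nlinarith [hU.le, hD]
  have hUE3 : U ≤ EngineV8.klEngU₀3 P R cc := by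
    refine hUle.trans ?_
    rw [div_le_iff₀ (by positivity)]
    nlinarith [hE3nn, hD]
  have hU1 : U ≤ 1 := hUE3.trans hE3le1
  have hUX : U ≤ 1 / (2 ^ 12 * (X + 1)) := hUle.trans (div_le_div_of_nonneg_right hE3le1 (by positivity))
  have hUd : U ≤ 1 / (2 ^ 12 * (R.Gfr 0 + R.Gfr 1 + R.cr + 1)) := by
    refine hUX.trans ?_
    rw [hXdef]
    exact one_div_le_one_div_of_le (by have := hRj 0; have := hRj 1; positivity) (by nlinarith [hRj 3])
  have hGU : R.Gfr 3 * U ≤ 1 := by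
    have h1 : R.Gfr 3 * U ≤ R.Gfr 3 * (1 / (2 ^ 12 * (X + 1))) := mul_le_mul_of_nonneg_left hUX (hRj 3)
    refine h1.trans ?_
    rw [← mul_div_assoc, mul_one, div_le_one (by positivity), hXdef]
    nlinarith [hRj 0, hRj 1, hRj 3, hcr]
  have hU3b : U ≤ min 1 (min (min ((bandBounds ha hab hb).Dtmin / 4) ((bandBounds ha hab hb).rhomin / 4)) (1 / 40) /
      (24 * (Rb.Gfr 0 + Rb.Gfr 1 + 1))) := by
    rw [hRb0, hRbj 1 one_ne_zero]
    set κ : ℝ := min (min ((bandBounds ha hab hb).Dtmin / 4) ((bandBounds ha hab hb).rhomin / 4)) (1 / 40) with hκ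
    refine le_min hU1 ?_
    have h1 : U * (2 ^ 12 * (X + 1)) ≤ κ / (24 * (R.Gfr 0 + R.Gfr 1 + 1)) := by
      have := hUle; rw [le_div_iff₀ (by positivity)] at this
      exact this.trans (hU3R.trans (min_le_right _ _))
    rw [le_div_iff₀ (by have := hRj 0; have := hRj 1; positivity)]
    rw [le_div_iff₀ (by have := hRj 0; have := hRj 1; positivity)] at h1
    have hcmp : 24 * (R.Gfr 0 + R.cr * klE0 + R.Gfr 1 + 1) ≤ 24 * (R.Gfr 0 + R.Gfr 1 + 1) * (2 ^ 12 * (X + 1)) := by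
      have he1 : klE0 ≤ 1 := by norm_num [klE0]
      rw [hXdef]; nlinarith [hRj 0, hRj 1, hRj 3, hcr, he.le, he1]
    calc U * (24 * (R.Gfr 0 + R.cr * klE0 + R.Gfr 1 + 1)) ≤ U * (24 * (R.Gfr 0 + R.Gfr 1 + 1) * (2 ^ 12 * (X + 1))) :=
          mul_le_mul_of_nonneg_left hcmp hU.le
      _ = U * (2 ^ 12 * (X + 1)) * (24 * (R.Gfr 0 + R.Gfr 1 + 1)) := by ring
      _ ≤ κ := h1
  have hLβ : β ^ 2 ≤ (L : ℝ) := EngineV8.sq_le_of_klEngL₃_le hL3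
  have hMβ : β ≤ (M : ℝ) := EngineV8.le_of_klEngM₃_le hβmin hL3 hM3
  -- the base frame, admissible; its order-three datum is that of `K_{m₀}`
  set Kb : TrigPolyC4v := fsub (klFlowFrameU L M β U μ m₀) (symInterp L fun _ =>
    ∑ m ∈ Ico m₀ n, klAngularMean (klLocalPart L M β U μ (klFlowFrameU L M β U μ m) m)) with hKb
  have hfr : FrameOK Rb U (nScales β) μ Kb := frameOK_meanFreeBase hR2 hμ hU hU1 hUd hcc.le hcc480 hreg hm1 hmn hnN hhist
  obtain ⟨N, rfl⟩ : ∃ N, m₀ = N + 1 := ⟨m₀ - 1, by omega⟩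
  have hh := (histP_klPredsV17F2_iff L M G P Q R β U μ 0 n).1 hhist
  have hJets : ∀ m ≤ N, FlowPieceJetsAt L M β U μ R m := fun m hm => (hh m (by omega)).2.1.2.1
  have hGeo : FlowGeometryAt L M β U μ N := (hh N (by omega)).2.1.2.2
  have hK1 : FrameOK R U N μ (klFlowFrameU L M β U μ (N + 1)) := frameOK_klFlowFrameU_succ hJets hGeo
  have hA3 : ∀ p : Momentum, ‖iteratedFDeriv ℝ 3 (frameShift Kb) p‖ ≤ R.Gfr 3 * U ^ 2 * ((4 : ℝ) ^ (N + 1) / 3) := by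
    intro p
    rw [hKb, iteratedFDeriv_frameShift_fsub_symInterp_const _ _ (by norm_num)]
    exact (frameShift_high_sizes_of_frameOK hRj hK1).1 p
  -- the datum at every level `m ≥ k + 1` on the deep window at the base depth
  have hdat : ∀ m : ℕ, k + 1 ≤ m → R.Gfr 3 * U ^ 2 * ((4 : ℝ) ^ (N + 1) / 3) * klScale klE0 m ^ 2 ≤ (4 : ℝ) ^ dd / 3072 :=
    fun m hm => frameDatumAt_le_of_pow_window hU.le hGU hm hnd
  -- the weighted neighbouring bounds on the window `[k + 1, J′]`, weight scale `J′`
  have hT : ∀ m : ℕ, k + 1 ≤ m → m ≤ J' → ∀ (ω : Fin (sectorCount m)) (a' : Fin (sectorCount (m - 1))),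
      ∑ z : TorusSite 1 (2 * M) × TorusSite 2 L,
        (1 + klScale klE0 J' * β / (2 * M) * |(((z.1 0).valMinAbs : ℤ) : ℝ)| + klScale klE0 J' * |(((z.2 0).valMinAbs : ℤ) : ℝ)| +
            klScale klE0 J' * |(((z.2 1).valMinAbs : ℤ) : ℝ)|) *
        ‖∑ q : TorusSite 1 (2 * M) × TorusSite 2 L, (torusChar q.1 z.1 * torusChar q.2 z.2) •
          (klAnisoFamily L M β μ Kb klE0 m ω (⟨(q.1 0).val, ZMod.val_lt (q.1 0)⟩, q.2) *
            klAnisoFamily L M β μ Kb klE0 (m - 1) a' (⟨(q.1 0).val, ZMod.val_lt (q.1 0)⟩, q.2))‖ ≤ CT * M * (L : ℝ) ^ 2 := by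
    intro m hkm hmJ ω a'
    have hbd := h Rb hRbnn cc U hcc hcleb hU hU3b β hβmin hβc μ hμ Kb hfr (R.Gfr 3 * U ^ 2 * ((4 : ℝ) ^ (N + 1) / 3)) hA3 L M hLβ hMβ m
      (by omega) (by omega) (hdat m hkm) ω a'
    refine le_trans (sum_le_sum fun z _ => mul_le_mul_of_nonneg_right ?_ (norm_nonneg _)) hbd
    have hΛle : klScale klE0 J' ≤ klScale klE0 m := EngineV8.klScale_le_klScale (by norm_num [klE0]) hmJ
    have h0 : 0 ≤ |(((z.1 0).valMinAbs : ℤ) : ℝ)| := abs_nonneg _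
    have h1 : 0 ≤ |(((z.2 0).valMinAbs : ℤ) : ℝ)| := abs_nonneg _
    have h2 : 0 ≤ |(((z.2 1).valMinAbs : ℤ) : ℝ)| := abs_nonneg _
    have hβM : 0 ≤ β / (2 * M) := by positivity
    have hΛ0 : 0 ≤ klScale klE0 J' := (klth_klScale_pos J').le
    have ht : klScale klE0 J' * β / (2 * M) ≤ klScale klE0 m * β / (2 * M) := by
      rw [mul_div_assoc, mul_div_assoc]; exact mul_le_mul_of_nonneg_right hΛle hβM
    gcongr
  -- the windowed jump package and the constants
  have hT0 : 0 ≤ CT * M * (L : ℝ) ^ 2 := by positivity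
  obtain ⟨hrow, hcol₁, hrow₁⟩ := overlapWt_jump_sums_le_of_nbWindow (L := L) (M := M) hβ0 μ Kb (n₀ := k + 1) hT0 hT le_rfl hJ
  have eTJ : CT * M * (L : ℝ) ^ 2 + 729 * ((((2 * M : ℕ) : ℝ) ^ 1 * (L : ℝ) ^ 2)⁻¹ * (CT * M * (L : ℝ) ^ 2) ^ 2) =
      (CT + 729 * CT ^ 2 / 2) * M * (L : ℝ) ^ 2 := by
    push_cast
    field_simp
  have e81 : ((27 : ℕ) : ℝ) * (3 * ((CT + 729 * CT ^ 2 / 2) * M * (L : ℝ) ^ 2) / (β * (L : ℝ) ^ 2)) =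
      81 * (CT + 729 * CT ^ 2 / 2) * M / β := by
    push_cast
    field_simp
    ring
  have e3 : 3 * ((CT + 729 * CT ^ 2 / 2) * M * (L : ℝ) ^ 2) / (β * (L : ℝ) ^ 2) = 3 * (CT + 729 * CT ^ 2 / 2) * M / β := by
    field_simp
  refine ⟨fun X'' => ?_, fun ω'' ω' σ c x' => ?_, fun ω'' ω' σ c x'' => ?_⟩
  · have h1 := hrow X''
    rw [eTJ, e81] at h1
    exact h1
  · have h1 := hcol₁ ω'' ω' σ c x'
    rw [eTJ, e3] at h1
    exact h1
  · have h1 := hrow₁ ω'' ω' σ c x''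
    rw [eTJ, e3] at h1
    exact h1


/-- **The same base overlap constants in the (K5′) chain's own spelling** `(μ + −Σ_{m<n} mean_m, K_{m₀} ⊖ (−Σ_{m<m₀} mean_m))`: the thin family
`klAnisoFamily` and the fat family `bgmFatMultiplier ∘ nambuXiCT` read the band only (`nambuXiCT_meanFree_eq_base`). Same constant, same binders.
[cite: BenfattoGiulianiMastropietro2006, §2.7 (2.71a), §2.8 (2.77), (2.82)–(2.83)] -/
theorem overlapWt_jump_sums_klEng_meanFreeBase_shifted (dd : ℕ) :
    ∃ CJ : ℝ, 0 < CJ ∧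
      ∀ (G : GeoConsts) (P : SplitConsts) (R : RenConsts) (Q : EngConsts) (cc : ℝ), R.WF2 → 0 < cc → cc ≤ EngineV8.klEngC₃6 P R →
      ∀ μ ∈ klWindowC, ∀ U : ℝ, 0 < U → U ≤ EngineV8.klEngU₀3 P R cc / (2 ^ 12 * (R.Gfr 0 + R.Gfr 1 + R.Gfr 3 + R.cr + 1)) →
      ∀ β : ℝ, klBetaMin ≤ β → β ≤ Real.exp (cc / U ^ 2) →
      ∀ (L M : ℕ) [NeZero L] [NeZero M], EngineV8.klEngL₃ β U ≤ L → EngineV8.klEngM₃ β U L ≤ M →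
      ∀ n : ℕ, n ≤ nScales β + 1 → IsKLRegime U cc (-(n : ℤ)) → HistP klPredsV17F2 L M G P Q R β U μ 0 n →
        ∀ m₀ : ℕ, 1 ≤ m₀ → m₀ ≤ n →
        ∀ k J' : ℕ, k + 1 ≤ J' → J' ≤ m₀ → (4 : ℝ) ^ m₀ * U ≤ (4 : ℝ) ^ (2 * (k + 1) + dd) →
        (∀ X'' : SpaceTimeIdx L M × SectorLeg (sectorCount J'),
          ∑ X', ‖(sectorAnalysisMatrix L M β (klAnisoFamily L M β (μ + -(∑ m ∈ range n, klAngularMean (klLocalPart L M β U μ (klFlowFrameU L M β U μ m) m))) (fsub (klFlowFrameU L M β U μ m₀) (symInterp L fun _ => -(∑ m ∈ range m₀, klAngularMean (klLocalPart L M β U μ (klFlowFrameU L M β U μ m) m)))) klE0 J') *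
            sectorSubMatrix L M β (bgmFatMultiplier L M klE0 β (nambuXiCT L (μ + -(∑ m ∈ range n, klAngularMean (klLocalPart L M β U μ (klFlowFrameU L M β U μ m) m))) (fsub (klFlowFrameU L M β U μ m₀) (symInterp L fun _ => -(∑ m ∈ range m₀, klAngularMean (klLocalPart L M β U μ (klFlowFrameU L M β U μ m) m))))) k)) X'' X'‖ *
              EngineV8.klScaleWt L M β J' {EngineV8.latticeLegPos (2 * (2 * M)) X'', EngineV8.latticeLegPos (2 * (2 * M)) X'} ≤
            81 * CJ * M / β) ∧
        (∀ (ω'' : Fin (sectorCount J')) (ω' : Fin (sectorCount k)) (σ c : Fin 2) (x' : SpaceTimeIdx L M),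
          ∑ x'' : SpaceTimeIdx L M, ‖(sectorAnalysisMatrix L M β (klAnisoFamily L M β (μ + -(∑ m ∈ range n, klAngularMean (klLocalPart L M β U μ (klFlowFrameU L M β U μ m) m))) (fsub (klFlowFrameU L M β U μ m₀) (symInterp L fun _ => -(∑ m ∈ range m₀, klAngularMean (klLocalPart L M β U μ (klFlowFrameU L M β U μ m) m)))) klE0 J') *
            sectorSubMatrix L M β (bgmFatMultiplier L M klE0 β (nambuXiCT L (μ + -(∑ m ∈ range n, klAngularMean (klLocalPart L M β U μ (klFlowFrameU L M β U μ m) m))) (fsub (klFlowFrameU L M β U μ m₀) (symInterp L fun _ => -(∑ m ∈ range m₀, klAngularMean (klLocalPart L M β U μ (klFlowFrameU L M β U μ m) m))))) k))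
              (x'', ((ω'', σ), c)) (x', ((ω', σ), c))‖ *
              EngineV8.klScaleWt L M β J'
                {EngineV8.latticeLegPos (2 * (2 * M)) ((x'', ((ω'', σ), c)) : SpaceTimeIdx L M × SectorLeg (sectorCount J')),
                  EngineV8.latticeLegPos (2 * (2 * M)) ((x', ((ω', σ), c)) : SpaceTimeIdx L M × SectorLeg (sectorCount k))} ≤
            3 * CJ * M / β) ∧
        (∀ (ω'' : Fin (sectorCount J')) (ω' : Fin (sectorCount k)) (σ c : Fin 2) (x'' : SpaceTimeIdx L M),
          ∑ x' : SpaceTimeIdx L M, ‖(sectorAnalysisMatrix L M β (klAnisoFamily L M β (μ + -(∑ m ∈ range n, klAngularMean (klLocalPart L M β U μ (klFlowFrameU L M β U μ m) m))) (fsub (klFlowFrameU L M β U μ m₀) (symInterp L fun _ => -(∑ m ∈ range m₀, klAngularMean (klLocalPart L M β U μ (klFlowFrameU L M β U μ m) m)))) klE0 J') *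
            sectorSubMatrix L M β (bgmFatMultiplier L M klE0 β (nambuXiCT L (μ + -(∑ m ∈ range n, klAngularMean (klLocalPart L M β U μ (klFlowFrameU L M β U μ m) m))) (fsub (klFlowFrameU L M β U μ m₀) (symInterp L fun _ => -(∑ m ∈ range m₀, klAngularMean (klLocalPart L M β U μ (klFlowFrameU L M β U μ m) m))))) k))
              (x'', ((ω'', σ), c)) (x', ((ω', σ), c))‖ *
              EngineV8.klScaleWt L M β J'
                {EngineV8.latticeLegPos (2 * (2 * M)) ((x'', ((ω'', σ), c)) : SpaceTimeIdx L M × SectorLeg (sectorCount J')),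
                  EngineV8.latticeLegPos (2 * (2 * M)) ((x', ((ω', σ), c)) : SpaceTimeIdx L M × SectorLeg (sectorCount k))} ≤
            3 * CJ * M / β) := by
  obtain ⟨CJ, hCJ, h⟩ := overlapWt_jump_sums_klEng_meanFreeBase dd
  refine ⟨CJ, hCJ, ?_⟩
  intro G P R Q cc hR2 hcc hcc6 μ hμ U hU hUle β hβmin hβc L M _ _ hL3 hM3 n hnN hreg hhist m₀ hm1 hmn k J' hJ hJm hnd
  have e1 := nambuXiCT_meanFree_eq_base (L := L) (M := M) β U μ hmn
  have e2 : klAnisoFamily L M β (μ + -(∑ m ∈ range n, klAngularMean (klLocalPart L M β U μ (klFlowFrameU L M β U μ m) m))) (fsub (klFlowFrameU L M β U μ m₀) (symInterp L fun _ => -(∑ m ∈ range m₀, klAngularMean (klLocalPart L M β U μ (klFlowFrameU L M β U μ m) m)))) klE0 J' = klAnisoFamily L M β μ (fsub (klFlowFrameU L M β U μ m₀) (symInterp L fun _ => ∑ m ∈ Ico m₀ n, klAngularMean (klLocalPart L M β U μ (klFlowFrameU L M β U μ m) m))) klE0 J' := by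
    simp only [klAnisoFamily, e1]
  rw [e1, e2]
  exact h G P R Q cc hR2 hcc hcc6 μ hμ U hU hUle β hβmin hβc L M hL3 hM3 n hnN hreg hhist m₀ hm1 hmn k J' hJ hJm hnd

end Summit.HubbardSuperconductivity.HubbardSuperconductivity.Theorems.TorusFourierL2

end
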